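import Mathlib
import Literature.AlgebraicGeometry.Resolution.PointBlowupFlagInvariant
import Literature.AlgebraicGeometry.Resolution.PointBlowupHeightVectorDrops
import Summits.ResolutionOfSingularities.ResolutionOfSingularities.Theorems.WeightedInvariantLocalWeightedDropInsepNewtonMeasures
import Summits.ResolutionOfSingularities.ResolutionOfSingularities.Theorems.WeightedInvariantLocalWeightedDropInsepNewtonVMove
import Summits.ResolutionOfSingularities.ResolutionOfSingularities.Theorems.WeightedInvariantLocalWeightedDropInsepNewtonVHeight

/-!
# `WeightedInvariant.LocalWeightedDrop`, line `hasse-ridge-face-selection`: the HORIZONTAL successor (Hauser–Wagner's move (H)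
# `F(yz, z)/z²`) in the lift's chart coordinates — support and `height(A′) ≤ height(A)` (unit M3, first part)

Crux item stmt-ResolutionOfSingularities-8899 `LocalWeightedDrop` (route `ResolutionOfSingularities/WeightedInvariant`),
serving the door `WeightedConstruction` stmt-ResolutionOfSingularities-0571.  [OURS · L1 W4.3, chain w43, stub worker 3
(gen 2): unit M3 (first part) of L/res-L1-w43-stub-3/S2iM-ATTACK-PLAN.md; the mathematics is Hauser–Wagner 2014 §6.1 (H)
p. 204 («It is obvious that height(F*) ≤ height(F)») for the typed measures; NOT a statement of any manuscript.]

Orientation BEFORE the move: free `= 0`, rigid `= 1`.  The chart of the lift at the point `c = (0, c₁)` of `E` off the flag point,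
live slot `1`, is `π_H : x₁ ↦ c₁X₀, x₀ ↦ X₀X₁`; the successor `A′` is defined by `π_H^* A = X₀² A′`, and AFTER the move the new
flag `E = {X₀ = 0}` is the rigid letter: rigid `= 0`, free `= 1` (the lift renumbers).
* `coeff_subst_piH`: `[X₀^a X₁^b] π_H^* A = c₁^{a−b} · [x₀^b x₁^{a−b}] A` (`b ≤ a`); `coeff_hSucc`; support transport
  `(α, β) ↦ (α + β − 2, α)`;
* `ordVarPS_hSucc_one`: the free order is KEPT (`ord_y(A′) = ord_y(A)`, HW Rem. 10 for the horizontal move);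
* `ordVarPS_hSucc_zero`: `ord_z(A′) + 2 = ord(A)`;  `degAlongPS_hSucc_le`: `α₁(A′) ≤ α₁(A)` (the vertex of lowest degree);
* `heightPS_hSucc_le`: **`height(A′) ≤ height(A)`** (new orientation `(rig, free) = (0, 1)` against the old `(1, 0)`).
-/

set_option linter.dupNamespace false -- mandated namespace of this single-conjunct summit

namespace Summit.ResolutionOfSingularities.ResolutionOfSingularities.Theorems

namespace InsepNewton

open MvPowerSeries
open Literature.AlgebraicGeometry.Resolution
open Literature.AlgebraicGeometry.Resolution.HauserPerlega2024 (ordAlong)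
open Literature.AlgebraicGeometry.Resolution.HauserWagner2014 (ordVarPS degAlongPS heightPS)

variable {K : Type} [Field K]

/-- The horizontal chart `π_H : x₁ ↦ c₁ X₀, x₀ ↦ X₀ X₁` in the lift's spelling (`c = (0, c₁)`, live slot `1`). -/
theorem piH_eq (c₁ : K) :
    (fun l : Fin 2 => if l = 1 then C ((![0, c₁] : Fin 2 → K) 1) * X 0 else
      X 0 * (C ((![0, c₁] : Fin 2 → K) l) + (X 1 : MvPowerSeries (Fin 2) K))) =
      fun l : Fin 2 => if l = 1 then C c₁ * X 0 else X 0 * X 1 := by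
  funext l
  rcases (by fin_cases l <;> simp : l = 0 ∨ l = 1) with rfl | rfl
  · simp
  · simp

/-- `π_H` is substitutable. -/
theorem hasSubst_piH (c₁ : K) : HasSubst (fun l : Fin 2 => if l = 1 then C c₁ * X 0 else (X 0 * X 1 : MvPowerSeries (Fin 2) K)) :=
  hasSubst_of_constantCoeff_zero fun l => by
    rcases (by fin_cases l <;> simp : l = 0 ∨ l = 1) with rfl | rfl <;> simp [constantCoeff_X]

/-- The monomial `x^d` under `π_H`: `c₁^{d₁} · X₀^{d₀+d₁} X₁^{d₀}`. -/
theorem prod_piH_pow (c₁ : K) (d : Fin 2 →₀ ℕ) :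
    (d.prod fun s n => (fun l : Fin 2 => if l = 1 then C c₁ * X 0 else (X 0 * X 1 : MvPowerSeries (Fin 2) K)) s ^ n) =
      monomial (Finsupp.single 0 (d 0 + d 1) + Finsupp.single 1 (d 0)) (c₁ ^ d 1) := by
  have hC : (C (c₁ ^ d 1) : MvPowerSeries (Fin 2) K) = monomial 0 (c₁ ^ d 1) := by
    ext e; rw [coeff_C, coeff_monomial]
  rw [Finsupp.prod_pow, Fin.prod_univ_two]
  simp only [Fin.isValue, ↓reduceIte, zero_ne_one]
  rw [mul_pow, mul_pow, ← map_pow, X_pow_eq, X_pow_eq, X_pow_eq, hC]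
  simp only [monomial_mul_monomial, mul_one, one_mul, zero_add]
  have hexp : (Finsupp.single (0 : Fin 2) (d 0) + Finsupp.single 1 (d 0) + Finsupp.single 0 (d 1) : Fin 2 →₀ ℕ) =
      Finsupp.single 0 (d 0 + d 1) + Finsupp.single 1 (d 0) := by
    rw [Finsupp.single_add]; abel
  rw [hexp]

/-- COEFFICIENTS OF `π_H^* A`: `[X₀^a X₁^b] = c₁^{a−b} · [x₀^b x₁^{a−b}] A` for `b ≤ a`, else `0`. -/
theorem coeff_subst_piH (c₁ : K) (A : MvPowerSeries (Fin 2) K) (e : Fin 2 →₀ ℕ) :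
    coeff e (subst (fun l : Fin 2 => if l = 1 then C c₁ * X 0 else (X 0 * X 1 : MvPowerSeries (Fin 2) K)) A) =
      if e 1 ≤ e 0 then c₁ ^ (e 0 - e 1) * coeff (Finsupp.single 0 (e 1) + Finsupp.single 1 (e 0 - e 1)) A else 0 := by
  classical
  rw [coeff_subst (hasSubst_piH c₁)]
  simp_rw [prod_piH_pow, coeff_monomial]
  have hkey : ∀ d : Fin 2 →₀ ℕ, (e = Finsupp.single 0 (d 0 + d 1) + Finsupp.single 1 (d 0)) ↔
      (e 1 ≤ e 0 ∧ d = Finsupp.single 0 (e 1) + Finsupp.single 1 (e 0 - e 1)) := by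
    intro d
    constructor
    · intro h
      have h0 : e 0 = d 0 + d 1 := by rw [h]; simp
      have h1 : e 1 = d 0 := by rw [h]; simp
      refine ⟨by omega, ?_⟩
      ext l
      rcases (by fin_cases l <;> simp : l = 0 ∨ l = 1) with rfl | rfl
      · simp; omega
      · simp; omega
    · rintro ⟨hle, rfl⟩
      ext l
      rcases (by fin_cases l <;> simp : l = 0 ∨ l = 1) with rfl | rfl
      · simp; omega
      · simp
  by_cases hle : e 1 ≤ e 0
  · rw [if_pos hle, finsum_eq_single _ (Finsupp.single 0 (e 1) + Finsupp.single 1 (e 0 - e 1))]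
    · rw [if_pos ((hkey _).mpr ⟨hle, rfl⟩), smul_eq_mul, mul_comm]
      congr 2
      simp
    · intro d hd
      rw [if_neg (fun h => hd ((hkey d).mp h).2), smul_zero]
  · rw [if_neg hle]
    exact finsum_eq_zero_of_forall_eq_zero fun d => by rw [if_neg (fun h => hle ((hkey d).mp h).1), smul_zero]

/-- COEFFICIENTS OF THE HORIZONTAL SUCCESSOR `A′` (`π_H^* A = X₀² A′`): `[X₀^a X₁^b] A′ = c₁^{a+2−b} · [x₀^b x₁^{a+2−b}] A`
for `b ≤ a + 2`, else `0`. -/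
theorem coeff_hSucc (c₁ : K) {A A' : MvPowerSeries (Fin 2) K}
    (hfac : subst (fun l : Fin 2 => if l = 1 then C c₁ * X 0 else (X 0 * X 1 : MvPowerSeries (Fin 2) K)) A = X 0 ^ 2 * A')
    (e : Fin 2 →₀ ℕ) :
    coeff e A' = if e 1 ≤ e 0 + 2 then c₁ ^ (e 0 + 2 - e 1) *
      coeff (Finsupp.single 0 (e 1) + Finsupp.single 1 (e 0 + 2 - e 1)) A else 0 := by
  classical
  have h : coeff (e + Finsupp.single 0 2) (X 0 ^ 2 * A') = coeff e A' := by
    rw [X_pow_eq, coeff_monomial_mul, if_pos (by simp), one_mul, add_tsub_cancel_right]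
  rw [← h, ← hfac, coeff_subst_piH]
  simp only [Finsupp.add_apply, Finsupp.single_eq_same, Finsupp.single_eq_of_ne (one_ne_zero : (1 : Fin 2) ≠ 0), add_zero]

/-- SUPPORT OF THE HORIZONTAL SUCCESSOR: `(a, b) ∈ supp A′ ↔ b ≤ a + 2 ∧ (b, a + 2 − b) ∈ supp A` (`c₁ ≠ 0`). -/
theorem coeff_hSucc_ne_zero_iff {c₁ : K} (hc₁ : c₁ ≠ 0) {A A' : MvPowerSeries (Fin 2) K}
    (hfac : subst (fun l : Fin 2 => if l = 1 then C c₁ * X 0 else (X 0 * X 1 : MvPowerSeries (Fin 2) K)) A = X 0 ^ 2 * A')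
    (a b : ℕ) :
    coeff (Finsupp.single 0 a + Finsupp.single 1 b) A' ≠ 0 ↔
      b ≤ a + 2 ∧ coeff (Finsupp.single 0 b + Finsupp.single 1 (a + 2 - b)) A ≠ 0 := by
  rw [coeff_hSucc c₁ hfac, pair_apply_zero, pair_apply_one]
  by_cases hle : b ≤ a + 2
  · rw [if_pos hle]
    simp [hle, pow_ne_zero _ hc₁]
  · rw [if_neg hle]
    simp [hle]

/-- … and the inverse transport: `(α, β) ∈ supp A`, `α + β ≥ 2` ⇒ `(α + β − 2, α) ∈ supp A′`. -/
theorem coeff_hSucc_ne_zero_of {c₁ : K} (hc₁ : c₁ ≠ 0) {A A' : MvPowerSeries (Fin 2) K}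
    (hfac : subst (fun l : Fin 2 => if l = 1 then C c₁ * X 0 else (X 0 * X 1 : MvPowerSeries (Fin 2) K)) A = X 0 ^ 2 * A')
    {α β : ℕ} (h2 : 2 ≤ α + β) (h : coeff (Finsupp.single 0 α + Finsupp.single 1 β) A ≠ 0) :
    coeff (Finsupp.single 0 (α + β - 2) + Finsupp.single 1 α) A' ≠ 0 := by
  rw [coeff_hSucc_ne_zero_iff hc₁ hfac]
  refine ⟨by omega, ?_⟩
  have : α + β - 2 + 2 - α = β := by omega
  rw [this]
  exact h

/-- The horizontal successor of a non-zero `A` of order `≥ 2` is non-zero. -/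
theorem hSucc_ne_zero {c₁ : K} (hc₁ : c₁ ≠ 0) {A A' : MvPowerSeries (Fin 2) K} (hA : A ≠ 0) (hA2 : (2 : ℕ∞) ≤ A.order)
    (hfac : subst (fun l : Fin 2 => if l = 1 then C c₁ * X 0 else (X 0 * X 1 : MvPowerSeries (Fin 2) K)) A = X 0 ^ 2 * A') :
    A' ≠ 0 := by
  obtain ⟨d, hd', -⟩ := exists_coeff_apply_eq_ordVarPS 1 hA
  have hd := coeff_single_add_single_ne_zero hd'
  have h := coeff_hSucc_ne_zero_of hc₁ hfac (two_le_add_of_coeff_ne_zero hA2 hd) hd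
  rintro rfl
  exact h (map_zero _)

/-- THE FREE ORDER IS KEPT by the horizontal move: `ord_y(A′) = ord_y(A)` (new free slot `1`, old free slot `0`). -/
theorem ordVarPS_hSucc_one {c₁ : K} (hc₁ : c₁ ≠ 0) {A A' : MvPowerSeries (Fin 2) K} (hA : A ≠ 0)
    (hA2 : (2 : ℕ∞) ≤ A.order)
    (hfac : subst (fun l : Fin 2 => if l = 1 then C c₁ * X 0 else (X 0 * X 1 : MvPowerSeries (Fin 2) K)) A = X 0 ^ 2 * A') :
    ordVarPS A' 1 = ordVarPS A 0 := by
  have hA' := hSucc_ne_zero hc₁ hA hA2 hfac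
  refine le_antisymm ?_ ?_
  · obtain ⟨d, hd', hd0⟩ := exists_coeff_apply_eq_ordVarPS 0 hA
    have hd := coeff_single_add_single_ne_zero hd'
    have h := coeff_hSucc_ne_zero_of hc₁ hfac (two_le_add_of_coeff_ne_zero hA2 hd) hd
    have := ordVarPS_le 1 h
    rw [pair_apply_one] at this
    rw [← hd0]; exact this
  · obtain ⟨e, he', he1⟩ := exists_coeff_apply_eq_ordVarPS 1 hA'
    have he := coeff_single_add_single_ne_zero he'
    obtain ⟨-, h⟩ := (coeff_hSucc_ne_zero_iff hc₁ hfac (e 0) (e 1)).mp he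
    have := ordVarPS_le 0 h
    rw [pair_apply_zero] at this
    rw [← he1]; exact this

/-- THE NEW RIGID ORDER: `ord_z(A′) + 2 = ord(A)` (new rigid slot `0`). -/
theorem ordVarPS_hSucc_zero {c₁ : K} (hc₁ : c₁ ≠ 0) {A A' : MvPowerSeries (Fin 2) K} (hA : A ≠ 0)
    (hA2 : (2 : ℕ∞) ≤ A.order)
    (hfac : subst (fun l : Fin 2 => if l = 1 then C c₁ * X 0 else (X 0 * X 1 : MvPowerSeries (Fin 2) K)) A = X 0 ^ 2 * A') :
    ((ordVarPS A' 0 + 2 : ℕ) : ℕ∞) = A.order := by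
  have hA' := hSucc_ne_zero hc₁ hA hA2 hfac
  refine le_antisymm ?_ ?_
  · obtain ⟨d, hd', hdeg⟩ := exists_coeff_ne_zero_and_order ((ne_zero_iff_order_finite (f := A)).mp hA)
    have hd := coeff_single_add_single_ne_zero hd'
    have h2 := two_le_add_of_coeff_ne_zero hA2 hd
    have h := coeff_hSucc_ne_zero_of hc₁ hfac h2 hd
    have hle := ordVarPS_le 0 h
    rw [pair_apply_zero] at hle
    have hdeg' : (d.degree : ℕ∞) = ((d 0 + d 1 : ℕ) : ℕ∞) := by
      conv_lhs => rw [show d = Finsupp.single 0 (d 0) + Finsupp.single 1 (d 1) by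
        ext l; rcases (by fin_cases l <;> simp : l = 0 ∨ l = 1) with rfl | rfl <;> simp]
      rw [degree_pair]
    rw [← hdeg, hdeg']
    exact_mod_cast (by omega : ordVarPS A' 0 + 2 ≤ d 0 + d 1)
  · obtain ⟨e, he', he0⟩ := exists_coeff_apply_eq_ordVarPS 0 hA'
    have he := coeff_single_add_single_ne_zero he'
    obtain ⟨hb, h⟩ := (coeff_hSucc_ne_zero_iff hc₁ hfac (e 0) (e 1)).mp he
    have hle := order_le h
    rw [degree_pair] at hle
    refine le_trans hle ?_
    rw [← he0]
    exact_mod_cast (by omega : e 1 + (e 0 + 2 - e 1) ≤ e 0 + 2)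

/-- THE NEW HIGHEST VERTEX IS NOT HIGHER: `α₁(A′) ≤ α₁(A)` — the monomial of least degree with least free exponent has free
exponent `≤ α₁` (else the old vertex would have smaller degree). -/
theorem degAlongPS_hSucc_le {c₁ : K} (hc₁ : c₁ ≠ 0) {A A' : MvPowerSeries (Fin 2) K} (hA : A ≠ 0)
    (hA2 : (2 : ℕ∞) ≤ A.order)
    (hfac : subst (fun l : Fin 2 => if l = 1 then C c₁ * X 0 else (X 0 * X 1 : MvPowerSeries (Fin 2) K)) A = X 0 ^ 2 * A') :
    degAlongPS A' 0 1 ≤ degAlongPS A 1 0 := by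
  have hA' := hSucc_ne_zero hc₁ hA hA2 hfac
  have hz := ordVarPS_hSucc_zero hc₁ hA hA2 hfac
  -- the old vertex `(α₁, β₁)` has degree `α₁ + β₁ ≥ ord A`; a support point of minimal degree `d` has `d 1 ≥ β₁`
  obtain ⟨v, hv', hv1, hv0⟩ := exists_vertex hA 1 0
  have hv := coeff_single_add_single_ne_zero hv'
  obtain ⟨d, hd', hdeg⟩ := exists_coeff_ne_zero_and_order ((ne_zero_iff_order_finite (f := A)).mp hA)
  have hd := coeff_single_add_single_ne_zero hd'
  have h2 := two_le_add_of_coeff_ne_zero hA2 hd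
  have hdeg' : (d.degree : ℕ∞) = ((d 0 + d 1 : ℕ) : ℕ∞) := by
    conv_lhs => rw [show d = Finsupp.single 0 (d 0) + Finsupp.single 1 (d 1) by
      ext l; rcases (by fin_cases l <;> simp : l = 0 ∨ l = 1) with rfl | rfl <;> simp]
    rw [degree_pair]
  -- `d` transported is on the new lowest rigid row
  have h := coeff_hSucc_ne_zero_of hc₁ hfac h2 hd
  have hrow : (Finsupp.single (0 : Fin 2) (d 0 + d 1 - 2) + Finsupp.single 1 (d 0) : Fin 2 →₀ ℕ) 0 = ordVarPS A' 0 := by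
    rw [pair_apply_zero]
    have : ((ordVarPS A' 0 + 2 : ℕ) : ℕ∞) = ((d 0 + d 1 : ℕ) : ℕ∞) := by rw [hz, ← hdeg, hdeg']
    have : ordVarPS A' 0 + 2 = d 0 + d 1 := by exact_mod_cast this
    omega
  have hle := degAlongPS_le (rig := 0) (free := 1) h hrow
  rw [pair_apply_one] at hle
  refine le_trans hle ?_
  -- `d 0 ≤ α₁`: the vertex `v` has `v 1 = β₁ ≤ d 1` and degree `≥` that of `d`
  have hβ : ordVarPS A 1 ≤ d 1 := by have := ordVarPS_le 1 hd; rwa [pair_apply_one] at this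
  have hvdeg : ((d 0 + d 1 : ℕ) : ℕ∞) ≤ ((v 0 + v 1 : ℕ) : ℕ∞) := by
    rw [← hdeg', hdeg, ← degree_pair]
    exact order_le hv
  have hvdeg' : d 0 + d 1 ≤ v 0 + v 1 := by exact_mod_cast hvdeg
  rw [← hv0]
  omega

/-- **HAUSER–WAGNER, MOVE (H): THE HEIGHT DOES NOT INCREASE** — `height(A′) ≤ height(A)` for the horizontal successor, the
new orientation being `(rig, free) = (0, 1)` (given coordinates; `A ≠ 0` of order `≥ 2`, `c₁ ≠ 0`).
[cite: HauserWagner2014, §6.1 (H) p. 204] -/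
theorem heightPS_hSucc_le {c₁ : K} (hc₁ : c₁ ≠ 0) {A A' : MvPowerSeries (Fin 2) K} (hA : A ≠ 0)
    (hA2 : (2 : ℕ∞) ≤ A.order)
    (hfac : subst (fun l : Fin 2 => if l = 1 then C c₁ * X 0 else (X 0 * X 1 : MvPowerSeries (Fin 2) K)) A = X 0 ^ 2 * A') :
    heightPS A' 0 1 ≤ heightPS A 1 0 := by
  have h1 := degAlongPS_hSucc_le hc₁ hA hA2 hfac
  have h2 := ordVarPS_hSucc_one hc₁ hA hA2 hfac
  rw [heightPS, heightPS, h2]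
  omega

end InsepNewton

end Summit.ResolutionOfSingularities.ResolutionOfSingularities.Theorems
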